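import Literature.NumberTheory.EllipticCurves.KatoTwistedFiniteness
import Literature.NumberTheory.EllipticCurves.ModularityVersionAp
import Literature.NumberTheory.EllipticCurves.ModularSymbolsHeckeProofs
import Mathlib.NumberTheory.DirichletCharacter.Bounds
import HarnessLib

/-!
# Kato's Cor. 14.3 (2) over `ℚ(ζ_m)`: all moduli from least moduli

`KatoTwistedFiniteness` vendors K. Kato, *`p`-adic Hodge theory and values of zeta functions of
modular forms*, Astérisque 295 (2004), Cor. 14.3 (2) (p. 235) — "Let `A` be an abelian variety
over `ℚ` such that there is a surjective homomorphism `J₁(N) → A` […]. Let `K` be a finite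
abelian extension of `ℚ`, let `χ : Gal(K/ℚ) → ℂˣ` be a character, and assume `L(A, χ, 1) ≠ 0`.
Then […] (2) The `χ`-part `A(K)^(χ)` is finite." — for `A = E` an elliptic curve over `ℚ` with
newform `f` and `K = ℚ(ζ_m)`, as the named fact `kato_finite_chiPart_of_twistedLValue_ne_zero`
(`X`): `m ≢ 2 (mod 4)`, so that `m` is the least modulus of `K` and the hypothesis `L(1) ≠ 0` on
the entire continuation of the mod-`m` series `twistedLSeries f χ = ∑ χ(n) aₙ(f) n⁻ˢ` is literally
Kato's `L_{prime(m)}(f, χ, 1) ≠ 0` (Kato §6.2, p. 161: `L_S(f, χ, s) = ∑_{(n,S)=1} aₙ χ(n) n⁻ˢ`,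
`S = prime(m)` for the smallest `m` with `K ⊂ ℚ(ζ_m)`, p. 235).

The ALL-MODULI form `T` of the same corollary — every `m ≥ 1`, same hypothesis on the mod-`m`
series, decidability instance on `ℚ(ζ_m)` quantified — is NOT a second named fact: it is the
explicit statement of the theorem `kato_finite_chiPart_cyclotomic_of_twistedLValue_ne_zero_of`
below, which proves `T` from `X`, and `kato_finite_chiPart_cyclotomic_iff` records `T ↔ X`
(one Kato debt, `X`, not two). The reduction, for `m = 2d` with `d` odd:

1. `χ` mod `2d` is induced from a character `χ₀` mod `d` (`factorsThrough_of_two_mul`: a unit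
   mod `2d` is odd, so `(ℤ/2d)ˣ → (ℤ/d)ˣ` has trivial kernel);
2. on `re s > 2`, `∑ χ(n) aₙ n⁻ˢ = (1 - χ₀(2) a₂ 2⁻ˢ + 𝟙_N(2) χ₀(2)² 2^{1-2s}) ∑ χ₀(n) aₙ n⁻ˢ`
   (`twistedLSeries_changeLevel_two_mul`, from Hecke's relation
   `a_{2n} = a₂ aₙ - 𝟙_N(2) 2 a_{n/2}`, the tree's `IsNewform0.cuspCoeff_prime_mul`,
   Diamond–Shurman Prop. 5.8.5, by splitting the series over even and odd `n`), so by the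
   identity theorem the entire continuation `L₀` of the mod-`d` series
   (`exists_differentiable_eq_twistedLSeries_holds`) satisfies `L = P · L₀` and `L(1) ≠ 0`
   forces `L₀(1) ≠ 0` (`exists_continuation_changeLevel_two_mul`);
3. `X` over `ℚ(ζ_d)` (`d` odd, so `d ≢ 2 (mod 4)`) gives `E(ℚ(ζ_d))^(χ₀)` finite;
4. `-ζ_d` is a primitive `2d`-th root of unity, so `ℚ(ζ_d)` is a `2d`-th cyclotomic extension
   (`isCyclotomicExtension_two_mul`) and Mathlib's `IsCyclotomicExtension.algEquiv` gives
   `e : ℚ(ζ_{2d}) ≃ₐ[ℚ] ℚ(ζ_d)`; the injection `Point.map e : E(ℚ(ζ_{2d})) ↪ E(ℚ(ζ_d))`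
   intertwines `σ` with `e σ e⁻¹` (`Point.map_map`) and the cyclotomic characters agree,
   `cyclotomicCharacterOf χ σ = cyclotomicCharacterOf χ₀ (e σ e⁻¹)`
   (`cyclotomicCharacterOf_changeLevel_autCongr`: if `σ ζ = ζ^a` on `2d`-th roots of unity then
   `e σ e⁻¹` raises `d`-th roots of unity to the `a`-th power), whence `χ`-parts embed
   (`map_mem_chiPart`, `finite_chiPart_of_injective`) and `E(ℚ(ζ_{2d}))^(χ)` is finite.

For `m ≢ 2 (mod 4)`, `T` is `X` verbatim (all `DecidableEq` instances on a type are equal).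
No new named fact is introduced; `X` itself (Kato's theorem proper: Euler system of Beilinson
elements, explicit reciprocity laws, Thm. 12.5/14.2) is NOT proved here.

## References

* K. Kato, *`p`-adic Hodge theory and values of zeta functions of modular forms*, Astérisque 295
  (2004), 117–290: §6.2 (p. 161), Thm. 14.2 and Cor. 14.3 (p. 235), §14.6 (p. 237, reduction to
  `K = ℚ`). [Kato2004Asterisque]
* F. Diamond, J. Shurman, *A first course in modular forms*, GTM 228 (2005), Prop. 5.8.5.
* G. Shimura, *Introduction to the arithmetic theory of automorphic functions* (1971), Thm. 3.66.
-/

noncomputable section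

open scoped BigOperators

open WeierstrassCurve WeierstrassCurve.Affine CongruenceSubgroup Polynomial Complex

namespace Literature.NumberTheory.EllipticCurves

/-! ### Functoriality of Kato's `χ`-part -/

section ChiPartTransport

variable {G G' M M' R : Type*} [AddCommGroup M] [AddCommGroup M'] [CommRing R]

/-- **Functoriality of the `χ`-part.** If `φ : M →+ M'` intertwines operators `ρ g` on `M` and
`ρ' (e g)` on `M'` along a bijection `e : G ≃ G'` compatible with the characters
(`χ = χ' ∘ e`), then `φ` maps `M^(χ)` into `M'^(χ')`: an element `b = ∑ n_τ τ ∈ I_{χ'}` pulls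
back to `∑ n_{e g} g ∈ I_χ`. [folklore] -/
theorem map_mem_chiPart {ρ : G → M →+ M} {ρ' : G' → M' →+ M'} {χ : G → R} {χ' : G' → R}
    (φ : M →+ M') (e : G ≃ G') (hρ : ∀ g x, φ (ρ g x) = ρ' (e g) (φ x))
    (hχ : ∀ g, χ g = χ' (e g)) {x : M} (hx : x ∈ chiPart ρ χ) : φ x ∈ chiPart ρ' χ' := by
  intro b hb
  have key := hx (b.equivMapDomain e.symm) (by
    rw [Finsupp.sum_equivMapDomain]
    simpa only [hχ, Equiv.apply_symm_apply] using hb)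
  have h := congrArg φ key
  rw [map_zero, map_finsuppSum] at h
  simp only [map_zsmul, hρ, Finsupp.sum_equivMapDomain, Equiv.apply_symm_apply] at h
  exact h

/-- **Finiteness of `χ`-parts descends along equivariant injections**: with `φ`, `e` as in
`map_mem_chiPart` and `φ` injective, `M'^(χ')` finite implies `M^(χ)` finite. [folklore] -/
theorem finite_chiPart_of_injective {ρ : G → M →+ M} {ρ' : G' → M' →+ M'} {χ : G → R}
    {χ' : G' → R} (φ : M →+ M') (hφ : Function.Injective φ) (e : G ≃ G')
    (hρ : ∀ g x, φ (ρ g x) = ρ' (e g) (φ x)) (hχ : ∀ g, χ g = χ' (e g))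
    (hfin : Finite (chiPart ρ' χ')) : Finite (chiPart ρ χ) := by
  refine Finite.of_injective
    (fun x : chiPart ρ χ => (⟨φ x, map_mem_chiPart φ e hρ hχ x.2⟩ : chiPart ρ' χ')) ?_
  intro x y hxy
  exact Subtype.ext (hφ (congrArg Subtype.val hxy))

end ChiPartTransport

/-! ### Dirichlet characters mod `2d`, `d` odd, come from level `d` -/

section LevelTwoMul

variable {R : Type*} [CommMonoidWithZero R] {d : ℕ}

/-- For `d` odd, reduction `(ℤ/2d)ˣ → (ℤ/d)ˣ` has trivial kernel (it is the CRT bijection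
`(ℤ/2d)ˣ ≅ (ℤ/2)ˣ × (ℤ/d)ˣ = (ℤ/d)ˣ`): a unit `u` mod `2d` is odd, so `u ≡ 1 (mod d)` forces
`u ≡ 1 (mod 2d)`. [folklore] -/
theorem unitsMap_two_mul_eq_one [NeZero d] (hd : Odd d) {u : (ZMod (2 * d))ˣ}
    (hu : ZMod.unitsMap (dvd_mul_left d 2) u = 1) : u = 1 := by
  haveI : NeZero (2 * d) := ⟨mul_ne_zero two_ne_zero (NeZero.ne d)⟩
  have hval := congrArg (fun v : (ZMod d)ˣ => (v : ZMod d)) hu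
  simp only [ZMod.unitsMap_val, Units.val_one] at hval
  set a : ℕ := (u : ZMod (2 * d)).val with ha
  have hcop : a.Coprime (2 * d) := ZMod.val_coe_unit_coprime u
  have hlt : a < 2 * d := ZMod.val_lt _
  have hcast : ((u : ZMod (2 * d)).cast : ZMod d) = (a : ZMod d) := by
    rw [ha, ZMod.cast_eq_val]
  rw [hcast] at hval
  -- `a ≡ 1 (mod d)` and `a` odd, hence `a ≡ 1 (mod 2d)`; with `a < 2d` this gives `a = 1`.
  have hmodd : a ≡ 1 [MOD d] := by
    have h1 : ((a : ℕ) : ZMod d) = ((1 : ℕ) : ZMod d) := by rw [hval, Nat.cast_one]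
    exact (ZMod.natCast_eq_natCast_iff _ _ _).mp h1
  have hodd : Odd a := (Nat.Coprime.coprime_dvd_right (dvd_mul_right 2 d) hcop).odd_of_right
  have hmod2 : a ≡ 1 [MOD 2] := by
    rw [Nat.ModEq, Nat.odd_iff.mp hodd]
  have hmod : a ≡ 1 [MOD 2 * d] :=
    (Nat.modEq_and_modEq_iff_modEq_mul (Nat.coprime_two_left.mpr hd)).mp ⟨hmod2, hmodd⟩
  have ha1 : a = 1 := by
    rw [Nat.ModEq, Nat.mod_eq_of_lt hlt] at hmod
    rw [hmod]
    exact Nat.mod_eq_of_lt (by have := NeZero.pos d; omega)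
  ext
  rw [Units.val_one, ← ZMod.natCast_zmod_val (u : ZMod (2 * d)), ← ha, ha1, Nat.cast_one]

/-- Every Dirichlet character mod `2d` with `d` odd is induced from level `d` (the conductor of a
Dirichlet character is never `≡ 2 (mod 4)`). [folklore] -/
theorem factorsThrough_of_two_mul [NeZero d] (hd : Odd d) (χ : DirichletCharacter R (2 * d)) :
    χ.FactorsThrough d := by
  haveI : NeZero (2 * d) := ⟨mul_ne_zero two_ne_zero (NeZero.ne d)⟩
  refine (DirichletCharacter.factorsThrough_iff_ker_unitsMap (dvd_mul_left d 2)).mpr ?_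
  intro u hu
  rw [MonoidHom.mem_ker] at hu ⊢
  rw [unitsMap_two_mul_eq_one hd hu, map_one]

/-- A character induced from level `d` to level `2d` vanishes on even residues. [folklore] -/
theorem changeLevel_two_mul_apply_two_mul (χ₀ : DirichletCharacter R d) (n : ℕ) :
    DirichletCharacter.changeLevel (dvd_mul_left d 2) χ₀ ((2 * n : ℕ) : ZMod (2 * d)) = 0 := by
  refine MulChar.map_nonunit _ ?_
  rw [ZMod.isUnit_iff_coprime]
  exact Nat.not_coprime_of_dvd_of_dvd one_lt_two (dvd_mul_right 2 n) (dvd_mul_right 2 d)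

/-- A character induced from level `d` to level `2d` agrees with the level-`d` character on odd
residues. [folklore] -/
theorem changeLevel_two_mul_apply_two_mul_add_one (χ₀ : DirichletCharacter R d) (n : ℕ) :
    DirichletCharacter.changeLevel (dvd_mul_left d 2) χ₀ ((2 * n + 1 : ℕ) : ZMod (2 * d)) =
      χ₀ ((2 * n + 1 : ℕ) : ZMod d) := by
  by_cases h : (2 * n + 1).Coprime d
  · have h2 : (2 * n + 1).Coprime (2 * d) :=
      Nat.Coprime.mul_right (Nat.coprime_two_right.mpr (odd_two_mul_add_one n)) h
    have key := DirichletCharacter.changeLevel_eq_cast_of_dvd' χ₀ (dvd_mul_left d 2)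
      (a := ((2 * n + 1 : ℕ) : ℤ)) (by exact_mod_cast h2)
    simpa only [Int.cast_natCast] using key
  · rw [MulChar.map_nonunit _ (mt (ZMod.isUnit_iff_coprime _ _).mp fun h2 =>
        h (Nat.Coprime.coprime_dvd_right (dvd_mul_left d 2) h2)),
      MulChar.map_nonunit _ (mt (ZMod.isUnit_iff_coprime _ _).mp h)]

end LevelTwoMul

/-! ### The Euler factor at `2`: `L_{prime(2d)}(f, χ, s)` versus `L_{prime(d)}(f, χ₀, s)` -/

section EulerFactorTwo

open LSeries ModularForms

variable {N : ℕ} [NeZero N] {d : ℕ}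

/-- Hecke's relation at `p = 2` in weight `2`: `a_{2n} = a₂ aₙ - 𝟙_N(2) · 2 · 𝟙_{2 ∣ n} a_{n/2}`
(Diamond–Shurman Prop. 5.8.5; the tree's `IsNewform0.cuspCoeff_prime_mul`).
[cite: DiamondShurman2005, Prop. 5.8.5] -/
theorem ModularForms.IsNewform0.cuspCoeff_two_mul {f : CuspForm (Gamma0 N) 2} (hf : IsNewform0 f) (n : ℕ) :
    cuspCoeff f (2 * n) = cuspCoeff f 2 * cuspCoeff f n -
      (if 2 ∣ N then 0 else (2 : ℂ)) * (if 2 ∣ n then cuspCoeff f (n / 2) else 0) := by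
  have h := hf.cuspCoeff_prime_mul Nat.prime_two n
  rw [show (2 : ℤ) - 1 = 1 by norm_num, zpow_one] at h
  rw [h]
  split_ifs <;> push_cast <;> ring

/-- Absolute convergence of a twisted `L`-series of a weight-`2` cusp form on `Γ₀(N)` for
`re s > 2` (`|χ(n)| ≤ 1` and Hecke's bound). [folklore] -/
theorem LSeriesSummable_dirichlet_mul_cuspCoeff {m : ℕ} (f : CuspForm (Gamma0 N) 2) (χ : DirichletCharacter ℂ m)
    {s : ℂ} (hs : 2 < s.re) : LSeriesSummable (fun n ↦ χ n * cuspCoeff f n) s := by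
  have h0 : LSeriesSummable (cuspCoeff f) s :=
    LSeriesSummable_cuspCoeff_gamma0 f (by push_cast; linarith)
  refine Summable.of_norm_bounded h0.norm fun n => norm_term_le s ?_
  rw [norm_mul]
  exact mul_le_of_le_one_left (norm_nonneg _) (DirichletCharacter.norm_le_one χ _)

set_option maxHeartbeats 800000 in
/-- **The Euler factor at `2`.** For a newform `f ∈ S₂(Γ₀(N))`, `d ≥ 1`, a Dirichlet character
`χ₀` mod `d` and its induced character `χ` mod `2d` (which kills the even integers), on
`re s > 2`:
`∑ χ(n) aₙ n⁻ˢ = (1 - χ₀(2) a₂ 2⁻ˢ + 𝟙_N(2) χ₀(2)² 2 · 4⁻ˢ) · ∑ χ₀(n) aₙ n⁻ˢ`,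
i.e. `L_{prime(2d)}(f, χ, s)` is `L_{prime(d)}(f, χ₀, s)` (for `d` odd) deprived of its Euler
factor at `2` (Shimura 1971, Thm. 3.66; Kato, Astérisque 295, §6.2, p. 161). The proof only uses
Hecke's relation `a₂ aₙ = a_{2n} + 𝟙_N(2) 2 a_{n/2}` and splitting sums over even and odd `n`.
[cite: Kato2004Asterisque, §6.2 (p. 161)] -/
theorem twistedLSeries_changeLevel_two_mul {f : CuspForm (Gamma0 N) 2} (hf : IsNewform0 f)
    (χ₀ : DirichletCharacter ℂ d) {s : ℂ} (hs : 2 < s.re) :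
    twistedLSeries f (DirichletCharacter.changeLevel (dvd_mul_left d 2) χ₀) s =
      (1 - χ₀ (2 : ZMod d) * cuspCoeff f 2 * ((2 : ℂ) ^ s)⁻¹ +
        (if 2 ∣ N then 0 else (2 : ℂ)) * χ₀ (2 : ZMod d) ^ 2 * (((2 : ℂ) ^ s)⁻¹) ^ 2) *
      twistedLSeries f χ₀ s := by
  -- notation
  set χ := DirichletCharacter.changeLevel (dvd_mul_left d 2) χ₀ with hχdef
  set ν : ℂ := if 2 ∣ N then 0 else (2 : ℂ) with hν
  set c : ℂ := χ₀ (2 : ZMod d) with hc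
  set t : ℂ := ((2 : ℂ) ^ s)⁻¹ with ht
  set F₀ : ℕ → ℂ := term (fun n ↦ χ₀ n * cuspCoeff f n) s with hF₀
  set Fχ : ℕ → ℂ := term (fun n ↦ χ n * cuspCoeff f n) s with hFχ
  have h2s : (2 : ℂ) ^ s ≠ 0 := by
    rw [Ne, cpow_eq_zero_iff, not_and_or]; exact Or.inl two_ne_zero
  have hinj2 : Function.Injective fun k : ℕ => 2 * k := mul_right_injective₀ two_ne_zero
  have hinj21 : Function.Injective fun k : ℕ => 2 * k + 1 :=
    (add_left_injective 1).comp hinj2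
  -- summability
  have hS₀ : Summable F₀ := LSeriesSummable_dirichlet_mul_cuspCoeff f χ₀ hs
  have hSχ : Summable Fχ := LSeriesSummable_dirichlet_mul_cuspCoeff f χ hs
  -- pointwise facts
  have hχ_even : ∀ k, Fχ (2 * k) = 0 := fun k => by
    simp only [hFχ, term]
    split_ifs
    · rfl
    · rw [hχdef, changeLevel_two_mul_apply_two_mul, zero_mul, zero_div]
  have hχ_odd : ∀ k, Fχ (2 * k + 1) = F₀ (2 * k + 1) := fun k => by
    simp only [hFχ, hF₀, term, Nat.succ_ne_zero, if_false, hχdef,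
      changeLevel_two_mul_apply_two_mul_add_one]
  -- `F₀ (2k) = t · χ₀(2) χ₀(k) a_{2k} k⁻ˢ`
  have hpow2 : ∀ k : ℕ, ((2 * k : ℕ) : ℂ) ^ s = (2 : ℂ) ^ s * (k : ℂ) ^ s := fun k => by
    rw [Nat.cast_mul]
    exact_mod_cast natCast_mul_natCast_cpow 2 k s
  -- the key pointwise identity: `c a₂ t · F₀ n = F₀ (2n) + G n`, where
  -- `G n = ν · 𝟙_{2∣n} · χ₀(2n) a_{n/2} (2n)⁻ˢ`
  set G : ℕ → ℂ := fun n ↦ if n = 0 then 0 else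
    ν * (if 2 ∣ n then χ₀ ((2 * n : ℕ) : ZMod d) * cuspCoeff f (n / 2) else 0) /
      ((2 * n : ℕ) : ℂ) ^ s with hG
  have hkey : ∀ n, c * cuspCoeff f 2 * t * F₀ n = F₀ (2 * n) + G n := fun n => by
    rcases Nat.eq_zero_or_pos n with rfl | hn
    · simp [hF₀, hG]
    · have hn0 : n ≠ 0 := hn.ne'
      have h2n0 : 2 * n ≠ 0 := mul_ne_zero two_ne_zero hn0
      have hks : (n : ℂ) ^ s ≠ 0 := by
        rw [Ne, cpow_eq_zero_iff, not_and_or]; exact Or.inl (Nat.cast_ne_zero.mpr hn0)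
      simp only [hF₀, hG, term, if_neg hn0, if_neg h2n0, hpow2]
      rw [hf.cuspCoeff_two_mul n, ← hν, Nat.cast_mul, Nat.cast_two, map_mul, ← hc, ht]
      split_ifs <;> ring
  -- `G (2k) = ν c² t² · F₀ k` and `G (2k+1) = 0`
  have hG_even : ∀ k, G (2 * k) = ν * c ^ 2 * t ^ 2 * F₀ k := fun k => by
    rcases Nat.eq_zero_or_pos k with rfl | hk
    · simp [hG, hF₀]
    · have hk0 : k ≠ 0 := hk.ne'
      have h2k0 : 2 * k ≠ 0 := mul_ne_zero two_ne_zero hk0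
      have hks : (k : ℂ) ^ s ≠ 0 := by
        rw [Ne, cpow_eq_zero_iff, not_and_or]; exact Or.inl (Nat.cast_ne_zero.mpr hk0)
      have h4 : ((2 * (2 * k) : ℕ) : ℂ) ^ s = (2 : ℂ) ^ s * ((2 : ℂ) ^ s * (k : ℂ) ^ s) := by
        rw [hpow2 (2 * k), hpow2 k]
      simp only [hG, hF₀, term, if_neg hk0, if_neg h2k0, if_pos (dvd_mul_right 2 k), h4,
        Nat.mul_div_cancel_left k two_pos]
      rw [show (2 * (2 * k) : ℕ) = 2 * 2 * k by ring, Nat.cast_mul, Nat.cast_mul, Nat.cast_two,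
        map_mul, map_mul, ← hc, ht]
      ring
  have hG_odd : ∀ k, G (2 * k + 1) = 0 := fun k => by
    have : ¬ 2 ∣ 2 * k + 1 := by omega
    simp [hG, this]
  -- summability of the pieces
  have hS₀e : Summable fun k => F₀ (2 * k) := hS₀.comp_injective hinj2
  have hS₀o : Summable fun k => F₀ (2 * k + 1) := hS₀.comp_injective hinj21
  have hSχe : Summable fun k => Fχ (2 * k) := hSχ.comp_injective hinj2
  have hSχo : Summable fun k => Fχ (2 * k + 1) := hSχ.comp_injective hinj21
  have hSG : Summable G := by
    have : G = fun n => c * cuspCoeff f 2 * t * F₀ n - F₀ (2 * n) := by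
      funext n; rw [hkey n]; ring
    rw [this]
    exact (hS₀.mul_left _).sub hS₀e
  have hSGe : Summable fun k => G (2 * k) := hSG.comp_injective hinj2
  have hSGo : Summable fun k => G (2 * k + 1) := hSG.comp_injective hinj21
  -- the sums
  have hA : twistedLSeries f χ₀ s = ∑' n, F₀ n := rfl
  have hL : twistedLSeries f χ s = ∑' n, Fχ n := rfl
  have hsplit₀ : (∑' k, F₀ (2 * k)) + ∑' k, F₀ (2 * k + 1) = ∑' n, F₀ n :=
    tsum_even_add_odd hS₀e hS₀o
  have hsplitχ : ∑' n, Fχ n = ∑' k, F₀ (2 * k + 1) := by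
    rw [← tsum_even_add_odd hSχe hSχo]
    simp only [hχ_even, hχ_odd, tsum_zero, zero_add]
  have hsplitG : ∑' n, G n = ν * c ^ 2 * t ^ 2 * ∑' n, F₀ n := by
    rw [← tsum_even_add_odd hSGe hSGo]
    simp only [hG_even, hG_odd, tsum_zero, add_zero]
    exact tsum_mul_left
  have hmid : c * cuspCoeff f 2 * t * ∑' n, F₀ n = (∑' k, F₀ (2 * k)) + ∑' n, G n := by
    rw [← tsum_mul_left, ← hS₀e.tsum_add hSG]
    exact tsum_congr hkey
  rw [hL, hsplitχ, hA]
  -- assemble: `P · A = A - (c a₂ t) A + ν c² t² A = A - B = D`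
  have hD : ∑' k, F₀ (2 * k + 1) = (∑' n, F₀ n) - ∑' k, F₀ (2 * k) := by
    rw [← hsplit₀]; ring
  rw [hD]
  have e1 : (1 - c * cuspCoeff f 2 * t + ν * c ^ 2 * t ^ 2) * ∑' n, F₀ n =
      (∑' n, F₀ n) - c * cuspCoeff f 2 * t * (∑' n, F₀ n) + ν * c ^ 2 * t ^ 2 * ∑' n, F₀ n := by
    ring
  rw [e1, hmid, hsplitG]
  ring

end EulerFactorTwo

/-! ### `ℚ(ζ_{2d}) = ℚ(ζ_d)` for `d` odd, and the two cyclotomic characters -/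

section CyclotomicTwoMul

variable {d : ℕ} [NeZero d]

set_option backward.isDefEq.respectTransparency false in
/-- For `d` odd, `-ζ_d` is a primitive `2d`-th root of unity (the option identifies the two
`ℚ`-algebra structures on `CyclotomicField d ℚ`, as in `cyclotomicCharacterOf`). [folklore] -/
theorem isPrimitiveRoot_neg_zeta_two_mul (hd : Odd d) :
    IsPrimitiveRoot (-(IsCyclotomicExtension.zeta d ℚ (CyclotomicField d ℚ))) (2 * d) := by
  have hζ := IsCyclotomicExtension.zeta_spec d ℚ (CyclotomicField d ℚ)
  convert! IsPrimitiveRoot.orderOf (-(IsCyclotomicExtension.zeta d ℚ (CyclotomicField d ℚ)))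
  rw [neg_eq_neg_one_mul, (Commute.all _ _).orderOf_mul_eq_mul_orderOf_of_coprime]
  · rw [← hζ.eq_orderOf, orderOf_neg_one, if_neg (by rw [ringChar.eq_zero]; decide)]
  · rw [← hζ.eq_orderOf, orderOf_neg_one, if_neg (by rw [ringChar.eq_zero]; decide)]
    exact Nat.coprime_two_left.mpr hd

set_option backward.isDefEq.respectTransparency false in
/-- For `d` odd, `ℚ(ζ_d)` is a `2d`-th cyclotomic extension of `ℚ` (`ℚ(ζ_{2d}) = ℚ(ζ_d)`).
[folklore] -/
theorem isCyclotomicExtension_two_mul (hd : Odd d) :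
    IsCyclotomicExtension {2 * d} ℚ (CyclotomicField d ℚ) := by
  have h := IsCyclotomicExtension.union_of_isPrimitiveRoot {d} ℚ (CyclotomicField d ℚ)
    (isPrimitiveRoot_neg_zeta_two_mul hd)
  rw [Set.union_comm] at h
  exact (IsCyclotomicExtension.iff_union_of_dvd ℚ (CyclotomicField d ℚ)
    ⟨2 * d, Set.mem_singleton _, mul_ne_zero two_ne_zero (NeZero.ne d), dvd_mul_left d 2⟩).mpr h

variable [NeZero (2 * d)]

set_option backward.isDefEq.respectTransparency false in
/-- **Compatibility of the cyclotomic characters at levels `2d` and `d`.** Let `d` be odd,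
`e : ℚ(ζ_{2d}) ≃ ℚ(ζ_d)` a `ℚ`-isomorphism, `χ₀` a Dirichlet character mod `d` and `χ` its
induced character mod `2d`. For `σ ∈ Gal(ℚ(ζ_{2d})/ℚ)` with `σ(ζ) = ζ^a` on `2d`-th roots of
unity, the conjugate `e σ e⁻¹ ∈ Gal(ℚ(ζ_d)/ℚ)` raises `d`-th roots of unity to the `a`-th power,
so `χ(a) = χ₀(a mod d)`: the two cyclotomic characters agree (`I_χ = I_{χ₀}` in Kato's
notation, Astérisque 295, p. 235). [folklore] -/
theorem cyclotomicCharacterOf_changeLevel_autCongr (χ₀ : DirichletCharacter ℂ d)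
    (e : CyclotomicField (2 * d) ℚ ≃ₐ[ℚ] CyclotomicField d ℚ)
    (σ : CyclotomicField (2 * d) ℚ ≃ₐ[ℚ] CyclotomicField (2 * d) ℚ) :
    cyclotomicCharacterOf (DirichletCharacter.changeLevel (dvd_mul_left d 2) χ₀) σ =
      cyclotomicCharacterOf χ₀ (e.autCongr σ) := by
  ext
  rw [coe_cyclotomicCharacterOf_apply, coe_cyclotomicCharacterOf_apply,
    DirichletCharacter.changeLevel_eq_cast_of_dvd]
  congr 1
  -- the two exponents
  set u := (IsCyclotomicExtension.autEquivPow (CyclotomicField (2 * d) ℚ)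
    (cyclotomic.irreducible_rat (NeZero.pos (2 * d))) σ : (ZMod (2 * d))ˣ) with hu
  set v := (IsCyclotomicExtension.autEquivPow (CyclotomicField d ℚ)
    (cyclotomic.irreducible_rat (NeZero.pos d)) (e.autCongr σ) : (ZMod d)ˣ) with hv
  set ζ₂ := IsCyclotomicExtension.zeta (2 * d) ℚ (CyclotomicField (2 * d) ℚ) with hζ₂def
  set ζ₁ := IsCyclotomicExtension.zeta d ℚ (CyclotomicField d ℚ) with hζ₁def
  have hζ₂ : IsPrimitiveRoot ζ₂ (2 * d) := IsCyclotomicExtension.zeta_spec _ ℚ _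
  have hζ₁ : IsPrimitiveRoot ζ₁ d := IsCyclotomicExtension.zeta_spec _ ℚ _
  have hσ : ζ₂ ^ (u : ZMod (2 * d)).val = σ ζ₂ := hζ₂.autToPow_spec ℚ σ
  have hτ : ζ₁ ^ (v : ZMod d).val = (e.autCongr σ) ζ₁ := hζ₁.autToPow_spec ℚ (e.autCongr σ)
  -- `μ = e⁻¹ ζ₁` is a `2d`-th root of unity in `ℚ(ζ_{2d})`, hence a power of `ζ₂`
  obtain ⟨i, -, hi⟩ : ∃ i < 2 * d, ζ₂ ^ i = e.symm ζ₁ :=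
    hζ₂.eq_pow_of_pow_eq_one (by
      rw [pow_mul', ← map_pow, hζ₁.pow_eq_one, map_one, one_pow])
  have hσμ : σ (e.symm ζ₁) = (e.symm ζ₁) ^ (u : ZMod (2 * d)).val := by
    rw [← hi, map_pow, ← hσ]
    exact pow_right_comm _ _ _
  have hτ' : (e.autCongr σ) ζ₁ = ζ₁ ^ (u : ZMod (2 * d)).val := by
    rw [AlgEquiv.autCongr_apply, AlgEquiv.trans_apply, AlgEquiv.trans_apply, hσμ, map_pow,
      AlgEquiv.apply_symm_apply]
  rw [hτ'] at hτ
  -- compare exponents modulo `d = orderOf ζ₁`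
  have hτ2 : ζ₁ ^ (v : ZMod d).val = ζ₁ ^ ((u : ZMod (2 * d)).val % d) := by
    have h := pow_mod_orderOf ζ₁ (u : ZMod (2 * d)).val
    rw [← hζ₁.eq_orderOf] at h
    rw [h]
    exact hτ
  have hva : (v : ZMod d).val = (u : ZMod (2 * d)).val % d :=
    hζ₁.pow_inj (ZMod.val_lt _) (Nat.mod_lt _ (NeZero.pos d)) hτ2
  rw [ZMod.cast_eq_val, ← ZMod.natCast_zmod_val (v : ZMod d), hva, ZMod.natCast_mod]

end CyclotomicTwoMul

/-! ### Kato's Cor. 14.3 (2) over `ℚ(ζ_m)` for every `m` from the case `m ≢ 2 (mod 4)` -/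

section Assembly

open ModularForms

/-- The analytic step for `m = 2d`: if the mod-`2d` series `L_{prime(2d)}(f, χ, s)` has an entire
continuation `L` with `L(1) ≠ 0`, then the entire continuation `L₀` of the mod-`d` series
`L_{prime(d)}(f, χ₀, s)` (`exists_differentiable_eq_twistedLSeries_holds`) has `L₀(1) ≠ 0`,
because `L = P(2⁻ˢ) · L₀` identically for the Euler polynomial `P` at `2`
(`twistedLSeries_changeLevel_two_mul` and the identity theorem). [folklore] -/
theorem exists_continuation_changeLevel_two_mul {N : ℕ} [NeZero N] {d : ℕ} [NeZero d]
    {f : CuspForm (Gamma0 N) 2} (hf : IsNewform0 f) (χ₀ : DirichletCharacter ℂ d)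
    (hL : ∃ L : ℂ → ℂ, Differentiable ℂ L ∧
      (∀ s : ℂ, 2 < s.re →
        L s = twistedLSeries f (DirichletCharacter.changeLevel (dvd_mul_left d 2) χ₀) s) ∧
      L 1 ≠ 0) :
    ∃ L₀ : ℂ → ℂ, Differentiable ℂ L₀ ∧
      (∀ s : ℂ, 2 < s.re → L₀ s = twistedLSeries f χ₀ s) ∧ L₀ 1 ≠ 0 := by
  obtain ⟨L, hLd, hLs, hL1⟩ := hL
  obtain ⟨L₀, hL₀d, hL₀s⟩ := exists_differentiable_eq_twistedLSeries_holds f χ₀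
  refine ⟨L₀, hL₀d, hL₀s, fun h0 => hL1 ?_⟩
  set P : ℂ → ℂ := fun s => 1 - χ₀ (2 : ZMod d) * cuspCoeff f 2 * ((2 : ℂ) ^ s)⁻¹ +
    (if 2 ∣ N then 0 else (2 : ℂ)) * χ₀ (2 : ZMod d) ^ 2 * (((2 : ℂ) ^ s)⁻¹) ^ 2 with hP
  have h2 : ∀ s : ℂ, (2 : ℂ) ^ s ≠ 0 := fun s => by
    rw [Ne, cpow_eq_zero_iff, not_and_or]; exact Or.inl two_ne_zero
  have ht : Differentiable ℂ fun s : ℂ => ((2 : ℂ) ^ s)⁻¹ :=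
    (differentiable_id.const_cpow (Or.inl two_ne_zero)).inv h2
  have hPd : Differentiable ℂ P :=
    ((differentiable_const _).sub ((differentiable_const _).mul ht)).add
      ((differentiable_const _).mul (ht.pow 2))
  have hLP : L = fun s => P s * L₀ s := by
    refine AnalyticOnNhd.eq_of_eventuallyEq (z₀ := (3 : ℂ))
      (hLd.differentiableOn.analyticOnNhd isOpen_univ)
      ((hPd.mul hL₀d).differentiableOn.analyticOnNhd isOpen_univ) ?_
    have hopen : IsOpen {s : ℂ | 2 < s.re} := isOpen_lt continuous_const Complex.continuous_re
    have hmem : (3 : ℂ) ∈ {s : ℂ | 2 < s.re} := by simp; norm_num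
    filter_upwards [hopen.mem_nhds hmem] with s hs
    rw [hLs s hs, hL₀s s hs, twistedLSeries_changeLevel_two_mul hf χ₀ hs]
  rw [hLP]
  simp [h0]

set_option backward.isDefEq.respectTransparency false in
open scoped Classical in
/-- **Kato's Cor. 14.3 (2) over `ℚ(ζ_m)` for every `m ≥ 1`, from the vendored case
`m ≢ 2 (mod 4)`.** Let `E/ℚ` be an elliptic curve (Weierstrass model `W`) with newform
`f ∈ S₂(Γ₀(N))` (`IsNewformOf W f`), `m ≥ 1` ARBITRARY, `K = ℚ(ζ_m)` with any decidability
instance (Mathlib's group law on `E(K)` uses one; all are equal), and `χ` a Dirichlet character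
mod `m`, read on `Gal(K/ℚ) ≅ (ℤ/m)ˣ` as `cyclotomicCharacterOf χ`. If the mod-`m` twisted series
`twistedLSeries f χ = ∑ χ(n) aₙ(f) n⁻ˢ = L_{prime(m)}(f, χ, s)` (`re s > 2`) has an entire
continuation `L` with `L(1) ≠ 0`, then the `χ`-part `E(K)^(χ)` of the Mordell–Weil group (Galois
action `σ ↦ Point.map σ`) is finite — GIVEN the least-modulus statement
`kato_finite_chiPart_of_twistedLValue_ne_zero` (Kato, Astérisque 295, Cor. 14.3 (2), p. 235, as
vendored; hypothesis `hK`, NOT proved in the tree). This all-moduli form is a theorem schema with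
hypothesis `hK`, not a named fact of its own. Proof: for `m ≢ 2 (mod 4)` the two statements
coincide (the decidability instance on `ℚ(ζ_m)` being unique), and for `m = 2d`, `d` odd,
(i) `χ` mod `2d` is induced from `χ₀` mod `d` (`factorsThrough_of_two_mul`),
(ii) `L_{prime(2d)}(f, χ, 1) ≠ 0` forces `L_{prime(d)}(f, χ₀, 1) ≠ 0`
(`exists_continuation_changeLevel_two_mul`: the two differ by the entire Euler factor at `2`),
(iii) Kato's corollary over `ℚ(ζ_d)` gives `E(ℚ(ζ_d))^(χ₀)` finite, and (iv) a `ℚ`-isomorphism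
`e : ℚ(ζ_{2d}) ≃ ℚ(ζ_d)` (`isCyclotomicExtension_two_mul`, Mathlib
`IsCyclotomicExtension.algEquiv`) induces a `Gal`-equivariant injection
`E(ℚ(ζ_{2d})) ↪ E(ℚ(ζ_d))` matching the characters
(`cyclotomicCharacterOf_changeLevel_autCongr`), under which `χ`-parts embed
(`finite_chiPart_of_injective`). This is Kato's remark (p. 235) that `L(f, χ, s)` refers to the
least `m` with `K ⊂ ℚ(ζ_m)` — here `ℚ(ζ_{2d}) = ℚ(ζ_d)` and `I_χ = I_{χ₀}` — made rigorous.
[cite: Kato2004Asterisque, Cor. 14.3 (2) (p. 235)] -/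
theorem kato_finite_chiPart_cyclotomic_of_twistedLValue_ne_zero_of
    (hK : kato_finite_chiPart_of_twistedLValue_ne_zero)
    (W : WeierstrassCurve ℚ) [W.IsElliptic] {N : ℕ} [NeZero N] {f : CuspForm (Gamma0 N) 2}
    (hf : IsNewformOf W f) {m : ℕ} [NeZero m] [inst : DecidableEq (CyclotomicField m ℚ)]
    (χ : DirichletCharacter ℂ m)
    (hL : ∃ L : ℂ → ℂ, Differentiable ℂ L ∧
      (∀ s : ℂ, 2 < s.re → L s = twistedLSeries f χ s) ∧ L 1 ≠ 0) :
    Finite (chiPart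
      (fun σ : CyclotomicField m ℚ ≃ₐ[ℚ] CyclotomicField m ℚ =>
        Point.map (W' := W.toAffine) (σ : CyclotomicField m ℚ →ₐ[ℚ] CyclotomicField m ℚ))
      (fun σ => (cyclotomicCharacterOf χ σ : ℂ))) := by
  by_cases hm : m % 4 = 2
  swap
  · -- the decidability instance on `ℚ(ζ_m)` is unique
    have hinst : inst = Classical.decEq _ := Subsingleton.elim _ _
    subst hinst
    exact hK W hf hm χ hL
  -- `m = 2d` with `d` odd
  obtain ⟨d, rfl⟩ : ∃ d, m = 2 * d := ⟨m / 2, by omega⟩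
  have hd : Odd d := Nat.odd_iff.mpr (by omega)
  haveI : NeZero d := ⟨by rintro rfl; simp at hm⟩
  have hd4 : d % 4 ≠ 2 := by obtain ⟨k, rfl⟩ := hd; omega
  -- (i) `χ` is induced from level `d`
  obtain ⟨hdvd, χ₀, rfl⟩ := factorsThrough_of_two_mul hd χ
  -- (ii)+(iii) Kato over `ℚ(ζ_d)`
  have hfin := hK W hf hd4 χ₀ (exists_continuation_changeLevel_two_mul hf.1 χ₀ hL)
  -- (iv) transport along `e : ℚ(ζ_{2d}) ≃ ℚ(ζ_d)`
  haveI := isCyclotomicExtension_two_mul hd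
  let e : CyclotomicField (2 * d) ℚ ≃ₐ[ℚ] CyclotomicField d ℚ :=
    IsCyclotomicExtension.algEquiv {2 * d} ℚ (CyclotomicField (2 * d) ℚ) (CyclotomicField d ℚ)
  refine finite_chiPart_of_injective
    (Point.map (W' := W.toAffine) (e : CyclotomicField (2 * d) ℚ →ₐ[ℚ] CyclotomicField d ℚ))
    (Point.map_injective _) e.autCongr.toEquiv (fun σ x => ?_) (fun σ => ?_) hfin
  · rw [Point.map_map, Point.map_map]
    congr 1
    congr 1
    ext y
    simp
  · exact congrArg Units.val (cyclotomicCharacterOf_changeLevel_autCongr χ₀ e σ)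

open scoped Classical in
/-- The two forms of Kato's Cor. 14.3 (2) over `ℚ(ζ_m)` are equivalent: all moduli `m ≥ 1` (with
the mod-`m` series and any decidability instance on `ℚ(ζ_m)`; the statement of
`kato_finite_chiPart_cyclotomic_of_twistedLValue_ne_zero_of`) versus least moduli
`m ≢ 2 (mod 4)` (the named fact `kato_finite_chiPart_of_twistedLValue_ne_zero`). [folklore] -/
theorem kato_finite_chiPart_cyclotomic_iff :
    (∀ (W : WeierstrassCurve ℚ) [W.IsElliptic] {N : ℕ} [NeZero N] {f : CuspForm (Gamma0 N) 2}
      (_hf : IsNewformOf W f) {m : ℕ} [NeZero m] [DecidableEq (CyclotomicField m ℚ)]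
      (χ : DirichletCharacter ℂ m)
      (_hL : ∃ L : ℂ → ℂ, Differentiable ℂ L ∧
        (∀ s : ℂ, 2 < s.re → L s = twistedLSeries f χ s) ∧ L 1 ≠ 0),
      Finite (chiPart
        (fun σ : CyclotomicField m ℚ ≃ₐ[ℚ] CyclotomicField m ℚ =>
          Point.map (W' := W.toAffine) (σ : CyclotomicField m ℚ →ₐ[ℚ] CyclotomicField m ℚ))
        (fun σ => (cyclotomicCharacterOf χ σ : ℂ)))) ↔
      kato_finite_chiPart_of_twistedLValue_ne_zero :=
  ⟨fun hK W _ _ _ _ hf _ _ _ χ hL => hK W hf χ hL,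
    kato_finite_chiPart_cyclotomic_of_twistedLValue_ne_zero_of⟩

end Assembly

end Literature.NumberTheory.EllipticCurves

end
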